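import Literature.AnabelianGeometry.EtaleTheta.Discharge.Sec1DeltaXModClosureDtpY
import Literature.AnabelianGeometry.EtaleTheta.ZHatLevelDetermination
import Literature.AnabelianGeometry.AbsoluteAnabelian.ZHatCompletionAdicCompleteness
import Literature.AnabelianGeometry.SemiGraphs.TemperedCyclotomic
import HarnessLib

/-!
# [EtTh] §1 p. 12 «1 → Ẑ(1) → Δ^ell_X → Ẑ → 1»: the `Ẑ`-quotient half PROVED at the L3 interface, and the
# FACT-LIST reduction `DeltaEllExtension ⟸ DeltaYEllClosureIsoTate` (F-0657 ⟸ F-1697)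

Mochizuki, *The étale theta function and its Frobenioid-theoretic manifestations*, Publ. RIMS **45** (2009)
[EtTh], §1, PRIMS PDF p. 12 (printed 238): "`Δ_X = (Δ^tp_X)^∧` [where the `∧` denotes the profinite
completion]. Then we have a natural exact sequence `1 → Ẑ(1) → Δ^ell_X → Ẑ → 1` — where we write
`Δ^ell_X = Δ^ab_X = Δ_X/[Δ_X, Δ_X]`" [cite: MochizukiEtTh2009, §1 p.12].  Layer L2 of the abc-iut cell, seat
abc-iut-L2-t7 (gen 3); PROOF-ONLY (no `def`, no `instance`, no named fact); a read-only consumer of abc-iut-L3's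
frozen `SemiGraphs/TemperedCyclotomic.lean` (`OncePuncturedTemperedGroup.DeltaEllExtension` = FACT-LIST F-0657,
`DeltaYEllClosureIsoTate` = F-1697), nothing of it edited or restated.

For EVERY `D : OncePuncturedTemperedGroup K` (abc-iut-L3-t2's interface; NO origin binder):
* `DeltaEllZHat.zQuot_delta_surjective` — `Δ^tp_X ↠ Z` (a cusp decomposition group lies in `Π^tp_Y` and maps
  onto `G_K`);
* `DeltaEllZHat.exists_deltaEll_hom_zHat` — **the `→ Ẑ → 1` half of the display**: a continuous SURJECTIVE
  homomorphism `Λ̄ : Δ^ell_X ↠ Ẑ`, invariant under the conjugation action of `Π^tp_X` (`conjDeltaEll`), whose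
  kernel is — as a SUBSET of `Δ^ell_X` with its quotient topology — exactly the closure of the image of `Δ^tp_Y`
  (the carrier F-1697 names), and with `Λ̄(δ) = η(zQuot δ)` on `Δ^tp_X` (the profinite completion of
  `Gal(Y/X) = Z`).  Engine: `ClosureKerZHat` of `Sec1DeltaXModClosureDtpY.lean` at `ι := D.toHat`,
  `τ := D.zQuot`, descended modulo `[Δ_X,Δ_X]⁻` (`Ẑ` is commutative).
* `DeltaEllZHat.deltaEllExtension_of_deltaYEllClosureIsoTate` — **F-0657 ⟸ F-1697 for every origin `Ω`**:
  the Tate-twist clause of `DeltaEllExtension` is carried by the subgroup `T` that `DeltaYEllClosureIsoTate`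
  provides (its carrier set is `Ker Λ̄`); every other clause (closedness, `Π^tp_X` acts trivially on `Δ^ell_X/T`,
  the level family `λ_n : Δ^ell_X → ℤ/n` — surjective, open kernels, killing `T`, compatible, jointly injective
  modulo `T`, `λ_n(δ) = zQuot(δ) mod n`) is PROVED here.

HONEST FRAMING: [EtTh] is refereed; the L3 interface is DATA quoting print, asserted for no curve; group
structure only (the Tate twist `Ẑ(1)` is NOT proved here — it is exactly the content of F-1697); nothing here
bears on [IUTchIII] Cor. 3.12; typed ≠ proved elsewhere; no side is taken on any disputed claim.
-/

noncomputable section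

namespace Literature.AnabelianGeometry.EtaleTheta

open Literature.AnabelianGeometry.SemiGraphs
open Literature.AnabelianGeometry.AbsoluteAnabelian
open _root_.Topology
open scoped commutatorElement
open CategoryTheory ProfiniteGrp ProfiniteGrp.ProfiniteCompletion

namespace DeltaEllZHat

universe u

variable {K : Type u} [Field K] (D : OncePuncturedTemperedGroup K)

/-- **`Δ^tp_X ↠ Z`** ([EtTh] p. 12 "`Δ^tp_X/Δ^tp_Y ≅ Z`", p. 13): every element of `Z` is the image of an
element of `Δ^tp_X` — correct a preimage in `Π^tp_X` by an element of a cusp decomposition group (which lies in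
`Π^tp_Y = Ker(Π^tp_X ↠ Z)` and maps ONTO `G_K`, interface fields `le_ker_of_mem_cuspDecomp`,
`map_aug_eq_top_of_mem_cuspDecomp`). [cite: MochizukiEtTh2009, §1 p.13] -/
theorem zQuot_delta_surjective (k : Multiplicative ℤ) : ∃ δ ∈ D.delta, D.zQuot δ = k := by
  obtain ⟨g, hg⟩ := D.zQuot_surjective k
  obtain ⟨C, hC⟩ := D.cuspDecomp_nonempty
  have hmem : D.aug g ∈ (C.map D.aug.toMonoidHom : Subgroup (Field.absoluteGaloisGroup K)) := by
    rw [D.map_aug_eq_top_of_mem_cuspDecomp C hC]; exact Subgroup.mem_top _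
  obtain ⟨d, hdC, hd⟩ := hmem
  refine ⟨g * d⁻¹, ?_, ?_⟩
  · rw [TemperedArithmeticGroup.mem_delta_iff]
    have hd' : D.aug d = D.aug g := hd
    rw [map_mul, map_inv, hd', mul_inv_cancel]
  · have hdz : D.zQuot d = 1 := D.le_ker_of_mem_cuspDecomp C hC hdC
    rw [map_mul, map_inv, hdz, inv_one, mul_one, hg]

/-- **The `→ Ẑ → 1` half of "`1 → Ẑ(1) → Δ^ell_X → Ẑ → 1`"** ([EtTh] p. 12), for EVERY
`D : OncePuncturedTemperedGroup K`: a continuous surjective homomorphism `Λ̄ : Δ^ell_X → Ẑ`, invariant under the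
conjugation action of `Π^tp_X`, with kernel (as a subset of `Δ^ell_X`) the closure of the image of `Δ^tp_Y`, and
with `Λ̄(δ) = η(zQuot δ)` for `δ ∈ Δ^tp_X`. [cite: MochizukiEtTh2009, §1 p.12] -/
theorem exists_deltaEll_hom_zHat :
    ∃ Λ : D.DeltaEll →* ZHat, Continuous Λ ∧ Function.Surjective Λ ∧
      (∀ (g : D.Pi) (x : D.DeltaEll), Λ (D.conjDeltaEll g x) = Λ x) ∧
      ((Λ.ker : Set D.DeltaEll) = closure ((fun δ : D.delta =>
        (QuotientGroup.mk ⟨D.toHat δ, Subgroup.le_topologicalClosure _ ⟨δ, δ.2, rfl⟩⟩ : D.DeltaEll)) ''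
          {δ | (δ : D.Pi) ∈ D.piY})) ∧
      ∀ δ : D.delta, Λ (QuotientGroup.mk ⟨D.toHat δ, Subgroup.le_topologicalClosure _ ⟨δ, δ.2, rfl⟩⟩) =
        ZHatLevel.eta (Multiplicative.toAdd (D.zQuot δ)) := by
  classical
  have hι := D.isProfiniteCompletion_toHat
  haveI : CompactSpace D.PiHat := hι.compactSpace
  haveI : T2Space D.PiHat := hι.t2Space
  obtain ⟨Λ, hΛ⟩ := ClosureKerZHat.exists_hom_zHat hι D.zQuot D.isOpen_ker_zQuot
  have hA : ∃ σ ∈ D.delta, D.zQuot σ = Multiplicative.ofAdd 1 := zQuot_delta_surjective D _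
  have hker := ClosureKerZHat.ker_inf_closure_map_eq hι hΛ D.delta hA
  have hsurj := ClosureKerZHat.surjOn_closure_map hι hΛ D.delta (zQuot_delta_surjective D)
  -- `Λ` kills commutators, hence `[Δ_X,Δ_X]⁻`
  have hkerClosed : IsClosed ((Λ.toMonoidHom.ker : Subgroup D.PiHat) : Set D.PiHat) := by
    have : ((Λ.toMonoidHom.ker : Subgroup D.PiHat) : Set D.PiHat) = Λ ⁻¹' {1} := by
      ext x; simp [MonoidHom.mem_ker]
    rw [this]; exact isClosed_singleton.preimage Λ.continuous
  have hell : D.ellKerHat ≤ Λ.toMonoidHom.ker := by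
    refine Subgroup.topologicalClosure_minimal _ ?_ hkerClosed
    rw [Subgroup.commutator_le]
    intro a _ b _
    rw [MonoidHom.mem_ker]
    show Λ ⁅a, b⁆ = 1
    rw [commutatorElement_def, map_mul, map_mul, map_mul, map_inv, map_inv,
      ZHatCompletion.mul_comm (Λ a) (Λ b), mul_inv_cancel_right, mul_inv_cancel]
  -- restriction to `Δ_X` and descent to `Δ^ell_X`
  let ΛΔ : ↥D.deltaHat →* ZHat := Λ.toMonoidHom.comp D.deltaHat.subtype
  have hΛΔc : Continuous ΛΔ := Λ.continuous.comp continuous_subtype_val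
  have hle : D.ellKerHat.subgroupOf D.deltaHat ≤ ΛΔ.ker := fun y hy =>
    hell (Subgroup.mem_subgroupOf.1 hy)
  let Λb : D.DeltaEll →* ZHat := QuotientGroup.lift _ ΛΔ hle
  have hmk : ∀ y : ↥D.deltaHat, Λb (QuotientGroup.mk y) = Λ (y : D.PiHat) := fun y => rfl
  have hΛbc : Continuous Λb := by
    rw [(QuotientGroup.isQuotientMap_mk _).continuous_iff]
    have : (Λb ∘ QuotientGroup.mk) = ΛΔ := funext hmk
    rw [this]; exact hΛΔc
  refine ⟨Λb, hΛbc, ?_, ?_, ?_, ?_⟩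
  · -- surjective: `Λ(Δ_X) = Ẑ`
    intro z
    obtain ⟨d, hd, h⟩ := hsurj (Set.mem_univ z)
    exact ⟨QuotientGroup.mk ⟨d, hd⟩, h⟩
  · -- `Π^tp_X`-invariance: `Ẑ` is commutative
    intro g x
    obtain ⟨y, rfl⟩ := QuotientGroup.mk_surjective x
    show Λb (QuotientGroup.mk (D.conjDeltaHat g y)) = Λb (QuotientGroup.mk y)
    rw [hmk, hmk, OncePuncturedTemperedGroup.coe_conjDeltaHat, map_mul, map_mul, map_inv,
      ZHatCompletion.mul_comm (Λ (D.toHat g)) (Λ (y : D.PiHat)), mul_inv_cancel_right]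
  · -- the kernel as a subset of `Δ^ell_X`
    haveI : IsClosed ((D.ellKerHat.subgroupOf D.deltaHat : Subgroup ↥D.deltaHat) : Set ↥D.deltaHat) := by
      have : ((D.ellKerHat.subgroupOf D.deltaHat : Subgroup ↥D.deltaHat) : Set ↥D.deltaHat) =
          Subtype.val ⁻¹' (D.ellKerHat : Set D.PiHat) := by
        ext y; simp [Subgroup.mem_subgroupOf]
      rw [this]
      exact (Subgroup.isClosed_topologicalClosure _).preimage continuous_subtype_val
    apply le_antisymm
    · -- `Ker ⊆ closure`: lift to `Δ_X`, where the kernel IS the closure of `ι Δ^tp_Y`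
      intro x hx
      obtain ⟨y, rfl⟩ := QuotientGroup.mk_surjective x
      have hy1 : Λ (y : D.PiHat) = 1 := by rw [← hmk]; exact hx
      have hyN : (y : D.PiHat) ∈ ((D.delta ⊓ D.zQuot.ker).map D.toHat.toMonoidHom).topologicalClosure := by
        rw [← hker]; exact ⟨hy1, y.2⟩
      -- `y ∈` the closure, inside the subspace `Δ_X`, of `S₀ = {w | w.1 ∈ ι(Δ^tp_Y)}`
      let S₀ : Set ↥D.deltaHat := {w | (w : D.PiHat) ∈ D.toHat '' ((D.delta ⊓ D.zQuot.ker : Subgroup D.Pi) : Set D.Pi)}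
      have hyS : y ∈ closure S₀ := by
        rw [Topology.IsInducing.subtypeVal.closure_eq_preimage_closure_image]
        refine closure_mono ?_ hyN
        rintro _ ⟨δ, hδ, rfl⟩
        exact ⟨⟨D.toHat δ, Subgroup.le_topologicalClosure _ ⟨δ, hδ.1, rfl⟩⟩, ⟨δ, hδ, rfl⟩, rfl⟩
      have himg := image_closure_subset_closure_image (QuotientGroup.continuous_mk
        (N := D.ellKerHat.subgroupOf D.deltaHat)) ⟨y, hyS, rfl⟩
      refine closure_mono ?_ himg
      rintro _ ⟨w, ⟨δ, hδ, hw⟩, rfl⟩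
      refine ⟨⟨δ, hδ.1⟩, hδ.2, ?_⟩
      show QuotientGroup.mk _ = QuotientGroup.mk w
      congr 1
      exact Subtype.ext hw
    · -- `closure ⊆ Ker`: the kernel is closed and contains the image of `Δ^tp_Y`
      have hKc : IsClosed ((Λb.ker : Subgroup D.DeltaEll) : Set D.DeltaEll) := by
        have : ((Λb.ker : Subgroup D.DeltaEll) : Set D.DeltaEll) = Λb ⁻¹' {1} := by
          ext x; simp [MonoidHom.mem_ker]
        rw [this]; exact isClosed_singleton.preimage hΛbc
      refine closure_minimal ?_ hKc
      rintro _ ⟨δ, hδ, rfl⟩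
      have hδz : D.zQuot δ = 1 := hδ
      show Λb _ = 1
      rw [hmk]
      show Λ (D.toHat δ) = 1
      rw [hΛ δ, hδz]; rfl
  · -- values on `Δ^tp_X`
    intro δ
    rw [hmk]
    show Λ (D.toHat δ) = _
    rw [hΛ δ]; rfl

/-- Bookkeeping between the `ℕ+`-indexed level characters of `Ẑ` and the `ℕ`-indexed family the typed fact
`DeltaEllExtension` asks for: any family `f_N : A → ℤ/N` (`N ≥ 1`) extends to a family indexed by all `n : ℕ`
agreeing with `f` on positive `n` (transport along `ZMod.ringEquivCongr`; the value at `n = 0` is irrelevant).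
[cite: MochizukiEtTh2009, §1 p.12] -/
theorem exists_natFamily_of_pnatFamily {A : Type*} [Group A] (f : ∀ N : ℕ+, A →* Multiplicative (ZMod N)) :
    ∃ g : ∀ n : ℕ, A →* Multiplicative (ZMod n), ∀ (N : ℕ+) (a : A), g N a = f N a := by
  classical
  let castTo : ∀ (P : ℕ+) (n : ℕ), (P : ℕ) = n → (Multiplicative (ZMod P) →* Multiplicative (ZMod n)) :=
    fun P n h => AddMonoidHom.toMultiplicative ((ZMod.ringEquivCongr h : ZMod P ≃+* ZMod n) : ZMod P →+ ZMod n)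
  have hc : ∀ (n : ℕ) (hn : 0 < n), ((Nat.toPNat n hn : ℕ+) : ℕ) = n := fun n hn => rfl
  refine ⟨fun n => if hn : 0 < n then (castTo (Nat.toPNat n hn) n (hc n hn)).comp (f (Nat.toPNat n hn)) else 1,
    fun N a => ?_⟩
  have hpos : 0 < (N : ℕ) := N.pos
  beta_reduce
  rw [dif_pos hpos]
  show castTo (Nat.toPNat (N : ℕ) hpos) (N : ℕ) (hc (N : ℕ) hpos) (f (Nat.toPNat (N : ℕ) hpos) a) = f N a
  generalize hc (N : ℕ) hpos = h
  have e : Nat.toPNat (N : ℕ) hpos = N := PNat.eq rfl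
  revert h
  rw [e]
  intro h
  generalize f N a = y
  rw [← ofAdd_toAdd y]
  generalize Multiplicative.toAdd y = t
  haveI : NeZero (N : ℕ) := ⟨N.ne_zero⟩
  show Multiplicative.ofAdd ((ZMod.ringEquivCongr h : ZMod N ≃+* ZMod N) t) = Multiplicative.ofAdd t
  rw [← ZMod.intCast_zmod_cast t, map_intCast]

/-- **FACT-LIST reduction F-0657 ⟸ F-1697** ([EtTh] §1 p. 12): for every origin binder `Ω`, if the closure of
the image of `Δ^tp_Y` in `Δ^ell_X` is a `Π^tp_X`-stable Tate twist (`DeltaYEllClosureIsoTate Ω`, F-1697), then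
"`1 → Ẑ(1) → Δ^ell_X → Ẑ → 1`" holds in its typed form (`DeltaEllExtension Ω`, F-0657): the `Ẑ`-quotient and the
level family are supplied by `exists_deltaEll_hom_zHat`. [cite: MochizukiEtTh2009, §1 p.12] -/
theorem deltaEllExtension_of_deltaYEllClosureIsoTate (Ω : TemperedPiOrigin K)
    (h : OncePuncturedTemperedGroup.DeltaYEllClosureIsoTate Ω) :
    OncePuncturedTemperedGroup.DeltaEllExtension Ω := by
  classical
  intro D hD
  obtain ⟨T, hT, hTc, hTate, hTset⟩ := h D hD
  obtain ⟨Λ, hΛc, hΛs, hΛconj, hΛker, hΛδ⟩ := exists_deltaEll_hom_zHat D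
  have hTker : T = Λ.ker := SetLike.coe_injective (hTset.trans hΛker.symm)
  refine ⟨T, hT, hTc, hTate, fun g x => ?_, ?_⟩
  · rw [hTker, MonoidHom.mem_ker, map_mul, map_inv, hΛconj, inv_mul_cancel]
  obtain ⟨lam, hlam⟩ := exists_natFamily_of_pnatFamily (A := D.DeltaEll) fun N => (ZHatLevel.level N).comp Λ
  have hlam' : ∀ (N : ℕ+) (x : D.DeltaEll), lam N x = ZHatLevel.level N (Λ x) := fun N x => hlam N x
  refine ⟨lam, ?_, ?_, ?_, ?_, ?_, ?_⟩
  · -- surjective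
    intro n hn y
    obtain ⟨N, rfl⟩ : ∃ N : ℕ+, (N : ℕ) = n := ⟨Nat.toPNat n hn, rfl⟩
    obtain ⟨k, hk⟩ := ZMod.intCast_surjective (Multiplicative.toAdd y)
    obtain ⟨x, hx⟩ := hΛs (ZHatLevel.eta k)
    refine ⟨x, ?_⟩
    rw [hlam' N x, hx, ZHatLevel.level_eta, hk, ofAdd_toAdd]
  · -- open kernels
    intro n hn
    obtain ⟨N, rfl⟩ : ∃ N : ℕ+, (N : ℕ) = n := ⟨Nat.toPNat n hn, rfl⟩
    have : ((lam N).ker : Set D.DeltaEll) = Λ ⁻¹' ((ZHatLevel.level N).ker : Set ZHat) := by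
      ext x
      simp only [SetLike.mem_coe, MonoidHom.mem_ker, Set.mem_preimage, hlam' N x]
    rw [this]
    exact (ZHatLevel.isOpen_ker_level N).preimage hΛc
  · -- `T ≤ Ker λ_n`
    intro n hn x hx
    obtain ⟨N, rfl⟩ : ∃ N : ℕ+, (N : ℕ) = n := ⟨Nat.toPNat n hn, rfl⟩
    rw [hTker, MonoidHom.mem_ker] at hx
    rw [MonoidHom.mem_ker, hlam' N x, hx, map_one]
  · -- compatibility `λ_{nm} mod n = λ_n`
    intro n m hn hm x
    obtain ⟨N, rfl⟩ : ∃ N : ℕ+, (N : ℕ) = n := ⟨Nat.toPNat n hn, rfl⟩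
    obtain ⟨M, rfl⟩ : ∃ M : ℕ+, (M : ℕ) = m := ⟨Nat.toPNat m hm, rfl⟩
    have h1 : lam ((N : ℕ) * (M : ℕ)) x = ZHatLevel.level (N * M) (Λ x) := hlam' (N * M) x
    rw [h1, hlam' N x]
    exact ZHatLevel.cast_level_mul N M (Λ x)
  · -- jointly injective modulo `T`
    intro x hx
    rw [hTker, MonoidHom.mem_ker]
    refine ZHatLevel.ext_of_level fun N => ?_
    have h1 := hx N N.pos
    rw [hlam' N x] at h1
    rw [h1, map_one]
  · -- values on `Δ^tp_X`
    intro n hn δ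
    obtain ⟨N, rfl⟩ : ∃ N : ℕ+, (N : ℕ) = n := ⟨Nat.toPNat n hn, rfl⟩
    rw [hlam' N, hΛδ, ZHatLevel.level_eta]

end DeltaEllZHat

end Literature.AnabelianGeometry.EtaleTheta

end
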